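/-
Origin: expansion seat `planner-pub-hodgecm-pohl-g2-0`, handover 2026-08-18T03:57:00Z (`HOME/pub-hodgecm-pohl-g2/lean/Pohl2/MonomialHodge.lean`, md5 6ca2a38b, 269 lines);
landed by the gen-5 packager in gate run 20 as `HodgeCM/Proofs/Pohlmann/WeightHodge.lean` (import ^import Pohl2\.Monomials\b→import HodgeCM.Proofs.Pohlmann.WeightSpan ×1; stripped 3 #print/#check lines).
-/
/-
Copyright: pub-hodgecm formalisation cell (harness21, 2026). New file (not vendored).
Origin: HOME/pub-hodgecm-pohl-g2/lean/Pohl2/MonomialHodge.lean — session planner-pub-hodgecm-pohl-g2-0 (unit pub-hodgecm-pohl-g2),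
part (b) `PohlmannSpan`, generation 2.  Intended final place: `HodgeCM/Proofs/Pohlmann/WeightHodge.lean`
(module `HodgeCM.Proofs.Pohlmann.WeightHodge`).  WIP imports `Pohl2.X` → their final modules.
-/
import Summits.HodgeConjecture.HodgeCM.Proofs.Pohlmann.WeightSpan
import Summits.HodgeConjecture.HodgeCM.Proofs.PohlmannSpan

/-!
# Pohlmann's span theorem, V: Hodge types of weight vectors (M30 `Fact_weightHodge`) and the
unconditional-in-M29/M30 form of `PohlmannSpan`

* `eigen_mem_piece` — a `τ`-eigenclass in `H¹(A_{(K,Φ)}, ℂ)` has Hodge type `(1,0)` if `τ ∈ Φ` and `(0,1)` if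
  `τ ∉ Φ` (M12 `Fact_alphaLine` + Hodge symmetry: `conj` of a `τ`-eigenclass is a `τ̄`-eigenclass and `τ̄ ∈ Φ`);
* `pullC_mem_piece'` (M3 `pull_hodge`), `cupC_mem_piece` / `cupPowC_mem_piece` (N2 `Fact_cup_hodge`): pull-backs
  preserve and cup products add Hodge types; hence the eigen-monomial `fmono x k p` has Hodge type
  `(∑_i 1_{Θ_{j_i}}(τ_i), ∑_i (1 - 1_{Θ_{j_i}}(τ_i)))`, which for injective `p` is `(p_S, q_S)` of its weight
  `S = wtOf k p` (`fmono_mem_piece`, `sum_eq_sum_wtOf`);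
* `iSupIndep_weightSpace` — distinct weights have independent weight spaces (the separating operator of
  `HodgeCM.Proofs.PohlmannSpan`: `weightSpace_le_eigenspace` + `exists_separating_family`);
* `weightHodge_of_facts` — **M30 is a theorem** of `ModelAxioms` + N1 + N2 + N3 + N4: a weight vector of weight
  `S` lies in `⊕_T N_T` (`N_T` = span of the injective eigen-monomials of weight `T`, `N_T ⊆ V_T ∩ H^{p_T,q_T}`),
  and independence of the `V_T` kills the components `T ≠ S`; degree `0` by N3/N4;
* `pohlmannSpan_of_facts` — `PohlmannSpan` from `ModelAxioms` and the four textbook facts N1–N4, by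
  `pohlmannSpan_holds` (gen 1) with M29 := `weightSpan_of_facts`, M30 := `weightHodge_of_facts`.
Reference: Pohlmann, Ann. of Math. 88 (1968) §1; Gao–Ullmo, JIMJ 25 (2025) §3.1 (art. p. 11; arXiv:2411.12249 p. 9 L24–30), recalled there without
proof: "the component `H^{p,q}(A,ℂ)` … has a basis consisting of the `[P]` such that `|P ∩ Φ| = p` and `|P ∩ Φ̄| = q`" — in our notation: `e_S` has Hodge type `(Σ_j |S_j ∩ Θ_j|, Σ_j |S_j ∖ Θ_j|)`.
-/

noncomputable section

open scoped TensorProduct NumberField Classical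

namespace HodgeCM

open Literature.AlgebraicGeometry.Motives
open Literature.AlgebraicGeometry.Motives.HodgeStructure (EndAction conj ofRat conj_baseChange conj_smul
  conj_conj conj_mem_piece mem_piece_iff piece_of_add_eq piece_eq_bot_of_add_ne complexConj_top)

namespace Universe

variable {U : Universe}

/-! ### Hodge types: eigenclasses, pull-backs, cup products -/

/-- `conj` of a `σ`-eigenclass is a `σ̄`-eigenclass. -/
theorem conj_mem_eigenLine {K : CMField} {Φ : CMType K} {σ : K →+* ℂ} {y : U.CohC (U.cmAV K Φ) 1}
    (hy : y ∈ U.eigenLine K Φ σ) :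
    conj y ∈ U.eigenLine K Φ (NumberField.ComplexEmbedding.conjugate σ) := by
  rw [mem_eigenLine_iff] at hy ⊢
  intro e
  rw [← conj_baseChange, hy e, conj_smul, NumberField.ComplexEmbedding.conjugate_coe_eq]

/-- A `σ`-eigenclass in `H¹(A_{(K,Φ)}, ℂ)` has Hodge type `(1_Φ(σ), 1 - 1_Φ(σ))` (M12 `Fact_alphaLine` + Hodge symmetry). -/
theorem eigen_mem_piece (M : U.ModelAxioms) {K : CMField} {Φ : CMType K} {σ : K →+* ℂ}
    {y : U.CohC (U.cmAV K Φ) 1} (hy : y ∈ U.eigenLine K Φ σ) :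
    y ∈ (U.hodge (U.cmAV K Φ) 1).piece (ind Φ σ) (1 - ind Φ σ) := by
  by_cases hσ : σ ∈ Φ.1
  · have h1 : ind Φ σ = 1 := by simp [ind, hσ]
    rw [h1, sub_self]
    have hy' : y ∈ U.alphaLine K Φ σ := by rw [(M.alphaLine K Φ σ).1 hσ]; exact hy
    exact EndAction.eigenPiece_le_piece _ _ _ _ hy'
  · have h0 : ind Φ σ = 0 := by simp [ind, hσ]
    rw [h0, sub_zero]
    have hσ' : NumberField.ComplexEmbedding.conjugate σ ∈ Φ.1 := by
      by_contra h
      have h2 := (Φ.2 (NumberField.ComplexEmbedding.conjugate σ)).not.mp h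
      rw [not_not, NumberField.ComplexEmbedding.involutive_conjugate (K : Type) σ] at h2
      exact hσ h2
    have hcy : conj y ∈ U.alphaLine K Φ (NumberField.ComplexEmbedding.conjugate σ) := by
      rw [(M.alphaLine K Φ _).1 hσ']
      exact conj_mem_eigenLine hy
    have h3 := conj_mem_piece _ (EndAction.eigenPiece_le_piece _ _ _ _ hcy)
    rwa [conj_conj] at h3

/-- Pull-backs preserve Hodge types (M3 `pull_hodge`); variant of `Universe.pullC_mem_piece`
(`HodgeCM.Automorphic.Realisation`) without the hypothesis `p + q = k`. -/
theorem pullC_mem_piece' (hph : U.Fact_pull_hodge) {X Y : U.Var} (f : U.Mor X Y) (k : ℕ) {p q : ℤ}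
    {y : U.CohC Y k} (hy : y ∈ (U.hodge Y k).piece p q) : U.pullC f k y ∈ (U.hodge X k).piece p q := by
  by_cases hpq : p + q = (k : ℤ)
  · rw [mem_piece_iff _ hpq] at hy ⊢
    refine ⟨hph X Y f k p (Submodule.mem_map_of_mem hy.1), ?_⟩
    rw [conj_pullC]
    exact hph X Y f k q (Submodule.mem_map_of_mem hy.2)
  · rw [piece_eq_bot_of_add_ne _ hpq, Submodule.mem_bot] at hy ⊢
    rw [hy, map_zero]

/-- Cup products add Hodge types (N2 `Fact_cup_hodge`). -/
theorem cupC_mem_piece (hch : U.Fact_cup_hodge) (X : U.Var) {i j : ℕ} {p q p' q' : ℤ}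
    {x : U.CohC X i} {y : U.CohC X j} (hx : x ∈ (U.hodge X i).piece p q) (hy : y ∈ (U.hodge X j).piece p' q') :
    U.cupC X i j x y ∈ (U.hodge X (i + j)).piece (p + p') (q + q') := by
  by_cases hpq : p + q = (i : ℤ)
  · by_cases hpq' : p' + q' = (j : ℤ)
    · have h : (p + p') + (q + q') = ((i + j : ℕ) : ℤ) := by push_cast; linarith
      rw [mem_piece_iff _ hpq] at hx
      rw [mem_piece_iff _ hpq'] at hy
      rw [mem_piece_iff _ h]
      refine ⟨hch X i j p p' x y hx.1 hy.1, ?_⟩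
      rw [conj_cupC]
      exact hch X i j q q' _ _ hx.2 hy.2
    · rw [piece_eq_bot_of_add_ne _ hpq', Submodule.mem_bot] at hy
      rw [hy, map_zero]
      exact zero_mem _
  · rw [piece_eq_bot_of_add_ne _ hpq, Submodule.mem_bot] at hx
    rw [hx, map_zero, LinearMap.zero_apply]
    exact zero_mem _

/-- Iterated cup products add Hodge types. -/
theorem cupPowC_mem_piece (hch : U.Fact_cup_hodge) (X : U.Var) : ∀ (k : ℕ) (v : Fin (k + 1) → U.CohC X 1)
    (pd qd : Fin (k + 1) → ℤ), (∀ i, v i ∈ (U.hodge X 1).piece (pd i) (qd i)) →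
      U.cupPowC X k v ∈ (U.hodge X (k + 1)).piece (∑ i, pd i) (∑ i, qd i)
  | 0, v, pd, qd, h => by
    rw [Fin.sum_univ_one, Fin.sum_univ_one, cupPowC_zero_apply]
    exact h 0
  | k + 1, v, pd, qd, h => by
    rw [cupPowC_succ_apply, Fin.sum_univ_castSucc pd, Fin.sum_univ_castSucc qd]
    exact cupC_mem_piece hch X
      (cupPowC_mem_piece hch X k (Fin.init v) (fun i => pd i.castSucc) (fun i => qd i.castSucc)
        fun i => h i.castSucc) (h (Fin.last (k + 1)))

section CM

variable {F : CMField} {n : ℕ} {Θ : Fin (n + 1) → CMType F}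
  (x : (j : Fin (n + 1)) → ((F : Type) →+* ℂ) → U.CohC (U.cmAV F (Θ j)) 1)

/-- `pr_j^* x_{j,τ}` has Hodge type `(1_{Θ_j}(τ), 1 - 1_{Θ_j}(τ))`. -/
theorem fvec_mem_piece (M : U.ModelAxioms) (hx : ∀ j τ, x j τ ∈ U.eigenLine F (Θ j) τ)
    (q : Fin (n + 1) × ((F : Type) →+* ℂ)) :
    U.fvec x q ∈ (U.hodge (U.cmProd F Θ) 1).piece (ind (Θ q.1) q.2) (1 - ind (Θ q.1) q.2) :=
  pullC_mem_piece' (X := U.cmProd F Θ) M.pull_hodge _ 1 (eigen_mem_piece M (hx q.1 q.2))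

/-- The eigen-monomial `fmono x k p`, `p i = (j_i, τ_i)`, has Hodge type `(∑_i 1_{Θ_{j_i}}(τ_i), ∑_i (1 - 1_{Θ_{j_i}}(τ_i)))`. -/
theorem fmono_mem_piece (M : U.ModelAxioms) (hch : U.Fact_cup_hodge) (hx : ∀ j τ, x j τ ∈ U.eigenLine F (Θ j) τ)
    (k : ℕ) (p : Fin (k + 1) → Fin (n + 1) × ((F : Type) →+* ℂ)) :
    U.fmono x k p ∈ (U.hodge (U.cmProd F Θ) (k + 1)).piece
      (∑ i, ind (Θ (p i).1) (p i).2) (∑ i, (1 - ind (Θ (p i).1) (p i).2)) :=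
  cupPowC_mem_piece hch _ k _ _ _ fun i => fvec_mem_piece x M hx (p i)

omit x in
/-- Exponent bookkeeping: for injective `p`, `∑_i g(j_i, τ_i) = ∑_j ∑_{s ∈ (wtOf k p) j} g(j, s)`. -/
theorem sum_eq_sum_wtOf {k : ℕ} (p : Fin (k + 1) → Fin (n + 1) × ((F : Type) →+* ℂ))
    (hp : Function.Injective p) (g : Fin (n + 1) → ((F : Type) →+* ℂ) → ℤ) :
    ∑ i, g (p i).1 (p i).2 = ∑ j, ∑ s ∈ wtOf k p j, g j s := by
  rw [← Finset.sum_fiberwise Finset.univ (fun i => (p i).1) (fun i => g (p i).1 (p i).2)]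
  refine Finset.sum_congr rfl fun j _ => ?_
  rw [wtOf, Finset.sum_image]
  · refine Finset.sum_congr rfl fun i hi => ?_
    simp only [Finset.mem_filter, Finset.mem_univ, true_and] at hi
    rw [hi]
  · intro i hi i' hi' h
    simp only [Finset.coe_filter, Finset.mem_univ, true_and, Set.mem_setOf_eq] at hi hi'
    exact hp (Prod.ext (hi.trans hi'.symm) h)

omit x in
/-- **Distinct weights have independent weight spaces** (eigenspaces of the separating operator). -/
theorem iSupIndep_weightSpace (M : U.ModelAxioms) (k : ℕ) :
    iSupIndep fun S : Fin (n + 1) → Finset ((F : Type) →+* ℂ) => U.weightSpace F Θ S k := by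
  obtain ⟨j, a, c, hinj⟩ := Pohlmann.exists_separating_family (F := (F : Type)) n
  choose Mi hMi using fun i => exists_isFactorAct M F Θ (j i) (a i)
  have hinj' : Function.Injective (sepVal j a c) := hinj
  exact ((Module.End.eigenspaces_iSupIndep ((U.sepOp c Mi k).baseChange ℂ)).comp hinj').mono
    fun S => weightSpace_le_eigenspace hMi k S

omit x in
/-- M30 in positive degree. -/
theorem weightSpace_le_piece_succ (M : U.ModelAxioms) (hN1 : U.Fact_cupExterior) (hN2 : U.Fact_cup_hodge)
    (k : ℕ) (S : Fin (n + 1) → Finset ((F : Type) →+* ℂ)) :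
    U.weightSpace F Θ S (k + 1) ≤ (U.hodge (U.cmProd F Θ) (k + 1)).piece
      (∑ j, ∑ s ∈ S j, ind (Θ j) s) (∑ j, ∑ s ∈ S j, (1 - ind (Θ j) s)) := by
  obtain ⟨β, -, hβ⟩ := exists_integral_injective_eval F
  choose x hx _hx0 hsp using fun j => exists_eigenbasis M F (Θ j) β hβ
  -- `N T` : the span of the injective eigen-monomials of weight `T`
  let N : (Fin (n + 1) → Finset ((F : Type) →+* ℂ)) → Submodule ℂ (U.CohC (U.cmProd F Θ) (k + 1)) :=
    fun T => Submodule.span ℂ ((fun p => U.fmono x k p) '' {p | Function.Injective p ∧ wtOf k p = T})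
  have hNW : ∀ T, N T ≤ U.weightSpace F Θ T (k + 1) := fun T => by
    refine Submodule.span_le.2 ?_
    rintro _ ⟨p, ⟨hp, rfl⟩, rfl⟩
    exact (mem_weightSpace_iff _ _ _ _ _).2 (isWeightVector_fmono x M hx k p hp)
  have hNP : ∀ T, N T ≤ (U.hodge (U.cmProd F Θ) (k + 1)).piece
      (∑ j, ∑ s ∈ T j, ind (Θ j) s) (∑ j, ∑ s ∈ T j, (1 - ind (Θ j) s)) := fun T => by
    refine Submodule.span_le.2 ?_
    rintro _ ⟨p, ⟨hp, rfl⟩, rfl⟩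
    have h := fmono_mem_piece x M hN2 hx k p
    rwa [sum_eq_sum_wtOf p hp fun j s => ind (Θ j) s, sum_eq_sum_wtOf p hp fun j s => 1 - ind (Θ j) s] at h
  have htop : ⨆ T, N T = ⊤ := by
    rw [eq_top_iff, ← span_fmono_eq_top x M (hN1 F n Θ k) hsp, Submodule.span_le]
    rintro _ ⟨p, rfl⟩
    by_cases hp : Function.Injective p
    · exact Submodule.mem_iSup_of_mem (wtOf k p) (Submodule.subset_span ⟨p, ⟨hp, rfl⟩, rfl⟩)
    · rw [fmono_eq_zero_of_not_injective x (hN1 F n Θ k) p hp]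
      exact zero_mem _
  -- decompose a weight vector along `⊤ = N S ⊔ ⨆_{T ≠ S} N T` and kill the second component
  intro z hz
  have hz' : z ∈ ⨆ T, N T := by rw [htop]; trivial
  rw [iSup_split_single N S, Submodule.mem_sup] at hz'
  obtain ⟨y, hy, w, hw, rfl⟩ := hz'
  have hw' : w ∈ ⨆ (T) (_ : T ≠ S), U.weightSpace F Θ T (k + 1) := (iSup₂_mono fun T _ => hNW T) hw
  have hwS : w ∈ U.weightSpace F Θ S (k + 1) := by
    have h := Submodule.sub_mem _ hz (hNW S hy)
    rwa [add_sub_cancel_left] at h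
  have hw0 : w = 0 :=
    (Submodule.disjoint_def.1 (iSupIndep_def.1 (iSupIndep_weightSpace M (k + 1)) S)) w hwS hw'
  rw [hw0, add_zero]
  exact hNP S hy

omit x in
/-- M30 in degree zero: the weight `(∅)_j` has `(p, q) = (0, 0)` and `H⁰ = F⁰ ∩ conj F⁰` (N4); any other
weight space in `H⁰` is zero because the CM multiplications act trivially there (N3) while
`∏_{s ∈ S_j} s(2) = 2^{|S_j|} ≠ 1`. -/
theorem weightSpace_le_piece_zero (M : U.ModelAxioms) (hN3 : U.Fact_pull_H0) (hN4 : U.Fact_hodge_F0)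
    (S : Fin (n + 1) → Finset ((F : Type) →+* ℂ)) :
    U.weightSpace F Θ S 0 ≤ (U.hodge (U.cmProd F Θ) 0).piece
      (∑ j, ∑ s ∈ S j, ind (Θ j) s) (∑ j, ∑ s ∈ S j, (1 - ind (Θ j) s)) := by
  intro z hz
  by_cases hS : ∀ j, S j = ∅
  · obtain rfl : S = fun _ => ∅ := funext hS
    simp only [Finset.sum_empty, Finset.sum_const_zero]
    rw [piece_of_add_eq _ (by simp), hN4, complexConj_top]
    exact Submodule.mem_inf.2 ⟨trivial, trivial⟩
  · simp only [not_forall] at hS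
    obtain ⟨j₀, hj₀⟩ := hS
    obtain ⟨Ma, hMa⟩ := exists_isFactorAct M F Θ j₀ 2
    have h1 := (mem_weightSpace_iff _ _ _ _ _).1 hz j₀ _ Ma hMa
    have h2 : U.pullC Ma 0 z = z := by
      show (U.pull Ma 0).baseChange ℂ z = z
      rw [hN3, LinearMap.baseChange_id]
      rfl
    have h3 : (∏ s ∈ S j₀, s ((2 : 𝓞 F) : F)) = (2 : ℂ) ^ (S j₀).card := by
      rw [← Finset.prod_const]
      refine Finset.prod_congr rfl fun s _ => ?_
      rw [NumberField.RingOfIntegers.coe_eq_algebraMap, map_ofNat, map_ofNat]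
    rw [h2, h3] at h1
    have hm : (2 : ℂ) ^ (S j₀).card ≠ 1 := by
      have hc : (S j₀).card ≠ 0 := Finset.card_ne_zero.2 (Finset.nonempty_iff_ne_empty.2 hj₀)
      exact_mod_cast (Nat.one_lt_two_pow_iff.2 hc).ne'
    have h4 : ((2 : ℂ) ^ (S j₀).card - 1) • z = 0 := by rw [sub_smul, one_smul, ← h1, sub_self]
    have hz0 : z = 0 := (smul_eq_zero.1 h4).resolve_left (sub_ne_zero.2 hm)
    rw [hz0]
    exact zero_mem _

end CM

/-- **M30 `Fact_weightHodge` is a theorem** of `ModelAxioms` + N1 + N2 + N3 + N4: weight vectors of weight `S`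
have Hodge type `(p_S, q_S)`. -/
theorem weightHodge_of_facts (M : U.ModelAxioms) (hN1 : U.Fact_cupExterior) (hN2 : U.Fact_cup_hodge)
    (hN3 : U.Fact_pull_H0) (hN4 : U.Fact_hodge_F0) : U.Fact_weightHodge := by
  intro F n Θ k S
  cases k with
  | zero => exact weightSpace_le_piece_zero M hN3 hN4 S
  | succ k => exact weightSpace_le_piece_succ M hN1 hN2 k S

/-- **Pohlmann's span theorem from the model axioms and the four textbook facts N1–N4**
(`⋀^• H¹ = H^•` via cup; cup respects `F^•`; `End` acts trivially on `H⁰`; `F⁰ H^k = H^k`):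
the bespoke weight-space facts M29/M30 of `pohlmannSpan_holds` are discharged by `weightSpan_of_facts` and
`weightHodge_of_facts`. -/
theorem pohlmannSpan_of_facts (M : U.ModelAxioms) (hN1 : U.Fact_cupExterior) (hN2 : U.Fact_cup_hodge)
    (hN3 : U.Fact_pull_H0) (hN4 : U.Fact_hodge_F0) : U.PohlmannSpan :=
  pohlmannSpan_holds M (weightSpan_of_facts M hN1 hN3) (weightHodge_of_facts M hN1 hN2 hN3 hN4)

end Universe

end HodgeCM

end

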